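import Literature.MeasureTheory.Group.InvariantQuotientConjugacySum
import HarnessLib

/-!
# The sum over a conjugation-stable SUBSET of `Γ` rearranged by conjugacy classes:
`∫_{G ⧸ L} Σ_{γ ∈ S} F(x γ x⁻¹) dμ = Σ_{[γ] ⊆ S} d_γ ∫_{G ⧸ G_γ} F(y γ y⁻¹) dμ_γ`
(Gelbart, *Automorphic forms on adele groups* (1975), (9.11)–(9.13), Remark 9.23; Arthur, *A trace
formula for reductive groups I*, Duke Math. J. 45 (1978), §8 — the elliptic classes `𝔬`)

Topic `MeasureTheory/Group`; namespace `Literature.MeasureTheory.Group`. THEOREMS ONLY (no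
definition, no named fact, no instance, no `sorry`) over the accepted
★ `InvariantQuotientConjugacySum`, which proves the class-by-class rearrangement of the diagonal
kernel for `S = Γ` (ALL classes at once: `exists_lintegral_conjTsum_eq_tsum`, demanding the per-class
data — relatively open `H_γ`, closed `G_γ ⊇ H_γ` with `G_γ ⧸ H_γ` compact, invariant measures — at
EVERY class). The `𝔬`-expansion of the non-compact trace formula (Arthur (1978), §8; Rogawski
(1990), §2.2–2.3) unfolds ONE class `𝔬` of rational elements at a time — a union of `Γ`-conjugacy
classes, e.g. the fibre of a conjugation-invariant class map — and only the ELLIPTIC classes carry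
compact `G_γ ⧸ H_γ`; so the consumer needs the same rearrangement for an `L`-conjugation-stable
SUBSET `S ⊆ Γ`, with the per-class data demanded only at the classes inside `S`. That is this file;
the proofs are those of the accepted file with the class index `ConjClasses Γ` cut down to
`{c // rep c ∈ S}`, after which the accepted INDEX-GENERIC transfer to real∕complex integrands
(★ `integral_conjTsum_eq_tsum_of_lintegral{,_complex}`) applies verbatim.

* §1 `mem_iff_rep_mem_of_conjStable` — a `Γ`-stable `S ⊆ Γ` is a union of classes (+ two private plumbing lemmas);
  **`tsum_subset_eq_tsum_conjOrbit`** — `Σ'_{s ∈ S} f s = Σ'_{c : rep c ∈ S} Σ'_{s ∈ [rep c]} f s` in `[0, ∞]`;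
  **`conjTsum_subset_eq_tsum_conjOrbit`** — `conjTsum L S F = Σ'_{c : rep c ∈ S} conjTsum L [rep c] F`.
* §2 **`exists_lintegral_conjTsum_subset_eq_tsum`** — the `[0, ∞]`-valued geometric side over `S`:
  `∫_{G ⧸ L} Σ'_{s ∈ S} F(x s x⁻¹) dμ = Σ'_{c : rep c ∈ S} d_c ∫_{G ⧸ G_c} F(y (rep c) y⁻¹) dμ_c`,
  `d_c ∈ (0, ∞)`, per-class data only on `S`.
* §3 **`exists_integral_conjTsum_subset_eq_tsum_complex`** — the same constants serve the complex-valued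
  identity for every Borel `F : G → ℂ` whose absolute class kernel over `S` is integrable
  (★ `integral_conjTsum_eq_tsum_of_lintegral_complex`, index-generic).

## References

* S. Gelbart, *Automorphic forms on adele groups*, Ann. of Math. Studies 83 (1975), (9.11)–(9.13),
  Remark 9.23 [Gelbart1975].
* J. Arthur, *A trace formula for reductive groups I*, Duke Math. J. 45 (1978), §8 (the classes `𝔬`
  meeting no proper parabolic subgroup) — cited for the shape of the statement only.
-/

set_option autoImplicit false

noncomputable section

open _root_.MeasureTheory _root_.MeasureTheory.Measure _root_.Topology Set Filter
open scoped ENNReal NNReal Pointwise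

/- The coset spaces carry the Borel structures supplied as instance BINDERS (which take precedence
over Mathlib's quotient σ-algebra instance in every statement below), as in the accepted file. -/

namespace Literature.MeasureTheory.Group

/-! ## §1 A conjugation-stable subset of `Γ` is a union of classes; the sum splits accordingly -/

section Classes

variable {G : Type*} [Group G] (Γ : Subgroup G)

/-- **A `Γ`-conjugation-stable subset `S ⊆ Γ` is a union of conjugacy classes**: `γ ∈ S` iff the
chosen representative of its class lies in `S` (the set-theoretic half of the rearrangement
(9.12) ⟶ (9.13) of Gelbart (1975), cut down to `S`). [cite: Gelbart1975, (9.13)] -/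
theorem mem_iff_rep_mem_of_conjStable (rep : ConjClasses Γ → Γ) (hrep : ∀ c, ConjClasses.mk (rep c) = c)
    {S : Set G} (hS : ∀ δ ∈ Γ, ∀ s ∈ S, δ * s * δ⁻¹ ∈ S) (γ : Γ) :
    (γ : G) ∈ S ↔ ((rep (ConjClasses.mk γ) : Γ) : G) ∈ S := by
  set r : Γ := rep (ConjClasses.mk γ) with hr
  have hc : IsConj r γ := by
    rw [← ConjClasses.mk_eq_mk_iff_isConj, hr, hrep]
  obtain ⟨δ, hδ⟩ := isConj_iff.1 hc
  -- `δ r δ⁻¹ = γ` and `δ⁻¹ γ δ = r` inside `G`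
  have h1 : ((δ : Γ) : G) * (r : G) * ((δ : Γ) : G)⁻¹ = (γ : G) := by
    have h := congrArg (fun z : Γ => (z : G)) hδ
    simpa using h
  have h2 : ((δ⁻¹ : Γ) : G) * (γ : G) * ((δ⁻¹ : Γ) : G)⁻¹ = (r : G) := by
    rw [← h1]; push_cast; group
  constructor
  · intro hγ
    rw [← h2]
    exact hS _ (δ⁻¹).2 _ hγ
  · intro hrS
    rw [← h1]
    exact hS _ δ.2 _ hrS

/-- The conjugacy class of a representative inside a `Γ`-stable `S` stays inside `S` (plumbing).
[folklore] -/
private theorem conjOrbit_subset_of_conjStable {S : Set G} (hS : ∀ δ ∈ Γ, ∀ s ∈ S, δ * s * δ⁻¹ ∈ S)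
    {γ₀ : G} (hγ₀ : γ₀ ∈ S) : conjOrbit Γ γ₀ ⊆ S := by
  rintro s hs
  obtain ⟨δ, hδ, rfl⟩ := (mem_conjOrbit_iff Γ).1 hs
  exact hS δ hδ γ₀ hγ₀

/-- The conjugacy class of a representative outside a `Γ`-stable `S` misses `S` (plumbing).
[folklore] -/
private theorem conjOrbit_disjoint_of_conjStable (rep : ConjClasses Γ → Γ) {S : Set G}
    (hS : ∀ δ ∈ Γ, ∀ s ∈ S, δ * s * δ⁻¹ ∈ S) {c : ConjClasses Γ} (hc : ((rep c : Γ) : G) ∉ S)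
    {s : G} (hs : s ∈ conjOrbit Γ (rep c : G)) : s ∉ S := by
  intro hsS
  obtain ⟨δ, hδ, rfl⟩ := (mem_conjOrbit_iff Γ).1 hs
  have h := hS δ⁻¹ (Γ.inv_mem hδ) _ hsS
  rw [show δ⁻¹ * (δ * ((rep c : Γ) : G) * δ⁻¹) * δ⁻¹⁻¹ = ((rep c : Γ) : G) by group] at h
  exact hc h

/-- **Rearranging the sum over a `Γ`-stable `S ⊆ Γ` by the conjugacy classes it contains**: for
`f : G → [0, ∞]`, `Σ'_{s ∈ S} f s = Σ'_{c : rep c ∈ S} Σ'_{s ∈ conjOrbit Γ (rep c)} f s`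
(unconditional sums in `[0, ∞]`; ★ `tsum_subgroup_eq_tsum_conjOrbit` applied to the indicator of `S`,
whose class sums are the full class sums on the classes inside `S` and `0` on the others).
[cite: Gelbart1975, (9.13)] -/
theorem tsum_subset_eq_tsum_conjOrbit (rep : ConjClasses Γ → Γ)
    (hrep : ∀ c, ConjClasses.mk (rep c) = c) {S : Set G} (hSΓ : S ⊆ Γ)
    (hS : ∀ δ ∈ Γ, ∀ s ∈ S, δ * s * δ⁻¹ ∈ S) (f : G → ℝ≥0∞) :
    ∑' s : S, f s =
      ∑' c : {c : ConjClasses Γ // ((rep c : Γ) : G) ∈ S}, ∑' s : conjOrbit Γ (rep c.1 : G), f s := by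
  -- `Σ'_{s ∈ S} f s = Σ'_{γ ∈ Γ} 1_S f γ`
  have h0 : ∑' γ : Γ, S.indicator f γ = ∑' x : G, (Γ : Set G).indicator (S.indicator f) x :=
    tsum_subtype (Γ : Set G) (S.indicator f)
  have h1 : ∑' s : S, f s = ∑' γ : Γ, S.indicator f γ := by
    rw [tsum_subtype S f, h0]
    refine tsum_congr fun x => ?_
    by_cases hx : x ∈ S
    · rw [Set.indicator_of_mem (hSΓ hx), Set.indicator_of_mem hx]
    · rw [Set.indicator_of_notMem hx]
      by_cases hxΓ : x ∈ (Γ : Set G)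
      · rw [Set.indicator_of_mem hxΓ, Set.indicator_of_notMem hx]
      · rw [Set.indicator_of_notMem hxΓ]
  rw [h1, tsum_subgroup_eq_tsum_conjOrbit Γ rep hrep (S.indicator f)]
  -- the class sums of `1_S f`: full on the classes inside `S`, zero on the others
  have h2 : ∀ c : ConjClasses Γ, ∑' s : conjOrbit Γ (rep c : G), S.indicator f s =
      Set.indicator {c : ConjClasses Γ | ((rep c : Γ) : G) ∈ S}
        (fun c => ∑' s : conjOrbit Γ (rep c : G), f s) c := by
    intro c
    by_cases hc : ((rep c : Γ) : G) ∈ S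
    · rw [Set.indicator_of_mem (show c ∈ {c : ConjClasses Γ | ((rep c : Γ) : G) ∈ S} from hc)]
      exact tsum_congr fun s => Set.indicator_of_mem (conjOrbit_subset_of_conjStable Γ hS hc s.2) f
    · rw [Set.indicator_of_notMem (show c ∉ {c : ConjClasses Γ | ((rep c : Γ) : G) ∈ S} from hc)]
      exact (tsum_congr fun s => Set.indicator_of_notMem
        (conjOrbit_disjoint_of_conjStable Γ rep hS hc s.2) f).trans tsum_zero
  simp_rw [h2]
  exact (tsum_subtype {c : ConjClasses Γ | ((rep c : Γ) : G) ∈ S}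
    (fun c => ∑' s : conjOrbit Γ (rep c : G), f s)).symm

variable (L : Subgroup G)

/-- **The sum over conjugates in a stable subset is the sum of its class contributions**:
`conjTsum L S F = Σ'_{c : rep c ∈ S} conjTsum L (conjOrbit Γ (rep c)) F`, for `Γ ≤ L = Γ · C_L(Γ)` and
an `L`-stable `S ⊆ Γ` (in `[0, ∞]`). [cite: Gelbart1975, (9.13)] -/
theorem conjTsum_subset_eq_tsum_conjOrbit (hΓL : Γ ≤ L)
    (hLΓ : ∀ ℓ ∈ L, ∃ γ ∈ Γ, γ⁻¹ * ℓ ∈ Subgroup.centralizer (Γ : Set G))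
    (rep : ConjClasses Γ → Γ) (hrep : ∀ c, ConjClasses.mk (rep c) = c) {S : Set G} (hSΓ : S ⊆ Γ)
    (hS : ∀ ℓ ∈ L, ∀ s ∈ S, ℓ * s * ℓ⁻¹ ∈ S) (F : G → ℝ≥0∞) (x : G ⧸ L) :
    conjTsum L S hS F x =
      ∑' c : {c : ConjClasses Γ // ((rep c : Γ) : G) ∈ S},
        conjTsum L (conjOrbit Γ (rep c.1 : G)) (conj_mem_conjOrbit_of_exists Γ L hLΓ (rep c.1).2) F x := by
  induction x using QuotientGroup.induction_on with
  | H g =>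
    simp only [conjTsum_mk]
    exact tsum_subset_eq_tsum_conjOrbit Γ rep hrep hSΓ (fun δ hδ s hs => hS δ (hΓL hδ) s hs)
      fun s => F (g * s * g⁻¹)

end Classes

/-! ## §2 The geometric side over a stable subset: sum over the classes it contains -/

section Assembly

variable {G : Type*} [Group G] [TopologicalSpace G] [IsTopologicalGroup G] [LocallyCompactSpace G]
  [SecondCountableTopology G] [T2Space G] [MeasurableSpace G] [BorelSpace G]
  (Γ L : Subgroup G) [hL : IsClosed (L : Set G)] [Countable Γ] (hΓL : Γ ≤ L)
  (hLΓ : ∀ ℓ ∈ L, ∃ γ ∈ Γ, γ⁻¹ * ℓ ∈ Subgroup.centralizer (Γ : Set G))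
  (rep : ConjClasses Γ → Γ) (hrep : ∀ c, ConjClasses.mk (rep c) = c)
  {S : Set G} (hSΓ : S ⊆ Γ) (hS : ∀ ℓ ∈ L, ∀ s ∈ S, ℓ * s * ℓ⁻¹ ∈ S)
  (Hc Gc : {c : ConjClasses Γ // ((rep c : Γ) : G) ∈ S} → Subgroup G)
  (hHc : ∀ c g, g ∈ Hc c ↔ g ∈ L ∧ g * (rep c.1 : G) = (rep c.1 : G) * g)
  (hHG : ∀ c, Hc c ≤ Gc c) (hGc : ∀ c, ∀ g ∈ Gc c, g * (rep c.1 : G) = (rep c.1 : G) * g)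
  [hGcl : ∀ c, IsClosed ((Gc c : Subgroup G) : Set G)]
  [MeasurableSpace (G ⧸ L)] [BorelSpace (G ⧸ L)]
  [∀ c, MeasurableSpace (G ⧸ Hc c)] [∀ c, BorelSpace (G ⧸ Hc c)]
  [∀ c, MeasurableSpace (G ⧸ Gc c)] [∀ c, BorelSpace (G ⧸ Gc c)]
  (μ : Measure (G ⧸ L)) [SMulInvariantMeasure G (G ⧸ L) μ] [IsFiniteMeasureOnCompacts μ]
  (μH : ∀ c, Measure (G ⧸ Hc c)) [∀ c, SMulInvariantMeasure G (G ⧸ Hc c) (μH c)]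
  [∀ c, IsFiniteMeasureOnCompacts (μH c)]
  (μC : ∀ c, Measure (G ⧸ Gc c)) [∀ c, SMulInvariantMeasure G (G ⧸ Gc c) (μC c)]
  [∀ c, IsFiniteMeasureOnCompacts (μC c)]

include hΓL hLΓ hrep hSΓ hHc hHG in
/-- **The geometric side over a conjugation-stable subset `S ⊆ Γ`, class by class** (Gelbart (1975),
(9.13) restricted to the classes inside `S`; the shape in which Arthur (1978), §8 unfolds one class `𝔬`
of the `𝔬`-expansion). Let `G` be a locally compact second countable Hausdorff group, `Γ ≤ L ≤ G` with `L`
closed, `Γ` countable and `L = Γ · C_L(Γ)`, `S ⊆ Γ` stable under `L`-conjugation; for each conjugacy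
class `c` of `Γ` INSIDE `S` fix the subgroup `H_c = L ∩ C_G(rep c)` (relatively open in `L`), a closed
subgroup `G_c ⊇ H_c` centralising `rep c` with `G_c ⧸ H_c` compact, and non-zero `G`-invariant Borel
measures finite on compact sets `μ` on `G ⧸ L`, `μ_c^H` on `G ⧸ H_c`, `μ_c` on `G ⧸ G_c`. Then there are
constants `d_c ∈ (0, ∞)`, independent of `F`, with
`∫_{G ⧸ L} Σ'_{s ∈ S} F(x s x⁻¹) dμ(x) = Σ'_{c ⊆ S} d_c ∫_{G ⧸ G_c} F(y (rep c) y⁻¹) dμ_c(y)`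
for every Borel `F : G → [0, ∞]` (§1 + ★ `exists_lintegral_conjTsum_conjOrbit_eq` class by class).
CAVEAT as in the accepted file: `d_c` is not identified with a volume here.
[cite: Gelbart1975, (9.13) and Remark 9.23] -/
theorem exists_lintegral_conjTsum_subset_eq_tsum
    (hopen : ∀ c, IsOpen (((Hc c).subgroupOf L : Subgroup L) : Set L))
    [∀ c, CompactSpace (Gc c ⧸ (Hc c).subgroupOf (Gc c))]
    (hμ : μ ≠ 0) (hμH : ∀ c, μH c ≠ 0) (hμC : ∀ c, μC c ≠ 0) :
    ∃ d : {c : ConjClasses Γ // ((rep c : Γ) : G) ∈ S} → ℝ≥0∞, (∀ c, d c ≠ 0 ∧ d c ≠ ∞) ∧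
      ∀ F : G → ℝ≥0∞, Measurable F →
        ∫⁻ x, conjTsum L S hS F x ∂μ =
          ∑' c, d c * ∫⁻ y, descConj (rep c.1 : G) (Gc c) (hGc c) F y ∂(μC c) := by
  have key := fun c => exists_lintegral_conjTsum_conjOrbit_eq Γ L hΓL hLΓ (rep c.1).2 (Hc c) (Gc c)
    (hHc c) (hHG c) (hGc c) μ (μH c) (μC c) (hopen c) hμ (hμH c) (hμC c)
  choose d hd0 hdt hd using key
  refine ⟨d, fun c => ⟨hd0 c, hdt c⟩, fun F hF => ?_⟩
  haveI := countable_conjClasses Γ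
  have h1 : ∀ x, conjTsum L S hS F x =
      ∑' c : {c : ConjClasses Γ // ((rep c : Γ) : G) ∈ S}, conjTsum L (conjOrbit Γ (rep c.1 : G))
        (conj_mem_conjOrbit_of_exists Γ L hLΓ (rep c.1).2) F x :=
    conjTsum_subset_eq_tsum_conjOrbit Γ L hΓL hLΓ rep hrep hSΓ hS F
  simp_rw [h1]
  rw [lintegral_tsum fun c => ?_]
  · exact tsum_congr fun c => hd c F hF
  · haveI := countable_conjOrbit Γ (rep c.1 : G)
    exact (measurable_conjTsum L _ _ hL hF).aemeasurable

/-! ## §3 Complex integrands: the subset geometric side in the trace formula's currency -/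

include hΓL hLΓ hrep hSΓ hHc hHG in
/-- **The geometric side over a conjugation-stable subset, for complex test functions.** Under the
hypotheses of `exists_lintegral_conjTsum_subset_eq_tsum` there are `d_c ∈ (0, ∞)` (`c` ranging over the
classes inside `S`) such that BOTH the `[0, ∞]`-valued identity holds for every Borel `F ≥ 0` AND, for
every Borel `F : G → ℂ` with `∫_{G ⧸ L} Σ'_{s ∈ S} ‖F(x s x⁻¹)‖ dμ < ∞`, the sum over conjugates in `S` is
`μ`-integrable, every orbital integrand is integrable, the class series converges absolutely and
`∫_{G ⧸ L} Σ'_{s ∈ S} F(x s x⁻¹) dμ(x) = Σ'_{c ⊆ S} d_c ∫_{G ⧸ G_c} F(y (rep c) y⁻¹) dμ_c(y)`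
(§2 + the accepted INDEX-GENERIC transfer ★ `integral_conjTsum_eq_tsum_of_lintegral_complex`).
[cite: Gelbart1975, (9.13) and Remark 9.23] -/
theorem exists_integral_conjTsum_subset_eq_tsum_complex
    (hopen : ∀ c, IsOpen (((Hc c).subgroupOf L : Subgroup L) : Set L))
    [∀ c, CompactSpace (Gc c ⧸ (Hc c).subgroupOf (Gc c))]
    (hμ : μ ≠ 0) (hμH : ∀ c, μH c ≠ 0) (hμC : ∀ c, μC c ≠ 0) :
    ∃ d : {c : ConjClasses Γ // ((rep c : Γ) : G) ∈ S} → ℝ≥0∞, (∀ c, d c ≠ 0 ∧ d c ≠ ∞) ∧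
      (∀ F : G → ℝ≥0∞, Measurable F →
        ∫⁻ x, conjTsum L S hS F x ∂μ =
          ∑' c, d c * ∫⁻ y, descConj (rep c.1 : G) (Gc c) (hGc c) F y ∂(μC c)) ∧
      ∀ F : G → ℂ, Measurable F →
        ∫⁻ x, conjTsum L S hS (fun g => ‖F g‖ₑ) x ∂μ < ∞ →
          Integrable (conjTsum L S hS F) μ ∧
          (∀ c, Integrable (descConj (rep c.1 : G) (Gc c) (hGc c) F) (μC c)) ∧
          Summable (fun c => (d c).toReal *
            ∫ y, ‖descConj (rep c.1 : G) (Gc c) (hGc c) F y‖ ∂(μC c)) ∧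
          ∫ x, conjTsum L S hS F x ∂μ =
            ∑' c, ((d c).toReal : ℂ) * ∫ y, descConj (rep c.1 : G) (Gc c) (hGc c) F y ∂(μC c) := by
  obtain ⟨d, hd, hId⟩ := exists_lintegral_conjTsum_subset_eq_tsum Γ L hΓL hLΓ rep hrep hSΓ hS Hc Gc hHc
    hHG hGc μ μH μC hopen hμ hμH hμC
  haveI : Countable S :=
    Set.countable_coe_iff.2 ((Set.countable_coe_iff.1 (inferInstance : Countable Γ)).mono hSΓ)
  exact ⟨d, hd, hId, fun F hF hfin =>
    integral_conjTsum_eq_tsum_of_lintegral_complex L S hS μ (fun c => (rep c.1 : G)) Gc hGc μC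
      (fun c => (hd c).1) hId hF hfin⟩

end Assembly

end Literature.MeasureTheory.Group

end
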